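import Mathlib
import HarnessLib
import Literature.Analysis.FluidPDE.HalfLineOUBarrier

/-!
# Route `UnthreadedDoor`, crux `PoloidalLiouville` (stmt-NavierStokesRegularity-1222), WALL W1 — crux idea «null-time», AE-2′ tooling:
# elementary lemmas for the off-null half-line OU comparison

Calculus bookkeeping split out of `Theorems/UnthreadedDoorNetFluxHalfLineOUOffNull.lean` (400-line rule): the cubic barrier of
`Literature.Analysis.FluidPDE.HalfLineOU.exists_cubic_barrier` repackaged with its two comparison constants
(`exists_cubic_barrier_bounds`), the far-field quartic inequality (`quartic_farField_ineq`), the time-derivative and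
time-monotonicity facts of the factors `e^{−λ(σ−s₁)}`, `e^{ν(σ−s₁)}` (`hasDerivAt_expDecay_mul`, `hasDerivAt_expGrowth_mul`,
`exp_decay_sub_le`), and the `ρ`-derivatives of `1 + r⁴` (`hasDerivAt_one_add_pow_four`, `hasDerivAt_four_mul_pow_three`).
No NS content; 1222 / W1 / NS regularity OPEN.  `--supports stmt-NavierStokesRegularity-1222 --as helper`.  [folklore]
-/

noncomputable section

-- the summit and its single sub-problem share the name (CONVENTIONS §1)
set_option linter.dupNamespace false

open Set Function Filter Topology

namespace Summit.NavierStokesRegularity.NavierStokesRegularity.Theorems.PoloidalLiouville.NetFlux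

open Literature.Analysis.FluidPDE Literature.Analysis.FluidPDE.HalfLineOU

/-- **The cubic barrier with its comparison constants.**  For `C ≥ 0`: `K` with `K″ + (C − r/2)K′ + λK ≤ 0` on `r > 0`,
`1 ≤ K`, and constants `A₀, A₁ > 0` with `(1+r)³ ≤ A₀ K r`, `K r ≤ A₁ (1+r)³` on `r ≥ 0` (from `exists_cubic_barrier`:
`ε r³ ≤ K ≤ k_M + ε r³`, `A₀ = 8 + 8/ε`, `A₁ = k_M + ε`). [folklore] -/
theorem exists_cubic_barrier_bounds {C : ℝ} (hC : 0 ≤ C) :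
    ∃ (K K' K'' : ℝ → ℝ) (lam A₀ A₁ : ℝ), 0 < lam ∧ 0 < A₀ ∧ 0 < A₁ ∧
      (∀ r, HasDerivAt K (K' r) r) ∧ (∀ r, HasDerivAt K' (K'' r) r) ∧
      (∀ r, 0 < r → K'' r + (C - r / 2) * K' r + lam * K r ≤ 0) ∧
      (∀ r, 0 ≤ r → 1 ≤ K r) ∧ (∀ r, 0 ≤ r → (1 + r) ^ 3 ≤ A₀ * K r) ∧
      (∀ r, 0 ≤ r → K r ≤ A₁ * (1 + r) ^ 3) := by
  obtain ⟨K, K', K'', lam, ε, kM, hlam, hε, hkM, hK1, hK2, hKin, hKone, hKcub, hKup⟩ :=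
    exists_cubic_barrier hC
  set A₀ : ℝ := 8 + 8 / ε with hA₀
  set A₁ : ℝ := kM + ε with hA₁
  have hA₀0 : 0 < A₀ := by rw [hA₀]; positivity
  have hA₁0 : 0 < A₁ := by rw [hA₁]; positivity
  have h8A : (8 : ℝ) ≤ A₀ := by
    rw [hA₀]; have := div_pos (by norm_num : (0:ℝ) < 8) hε; linarith
  refine ⟨K, K', K'', lam, A₀, A₁, hlam, hA₀0, hA₁0, hK1, hK2, hKin, hKone, fun r hr => ?_, fun r hr => ?_⟩
  · have h1 := hKone r hr
    have h2 := hKcub r hr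
    rcases le_or_gt r 1 with hr1 | hr1
    · have h3 : (1 + r) ^ 3 ≤ (2 : ℝ) ^ 3 := pow_le_pow_left₀ (by linarith) (by linarith) 3
      have h4 : (8 : ℝ) * 1 ≤ A₀ * K r := mul_le_mul h8A h1 zero_le_one hA₀0.le
      norm_num at h3
      linarith
    · have h3 : (1 + r) ^ 3 ≤ (2 * r) ^ 3 := pow_le_pow_left₀ (by linarith) (by linarith) 3
      have h3' : (2 * r) ^ 3 = 8 * r ^ 3 := by ring
      have h4 : 8 * r ^ 3 = (8 / ε) * (ε * r ^ 3) := by field_simp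
      have h5 : (8 / ε) * (ε * r ^ 3) ≤ (8 / ε) * K r :=
        mul_le_mul_of_nonneg_left h2 (by positivity)
      have h6 : (8 / ε) * K r ≤ A₀ * K r := by
        apply mul_le_mul_of_nonneg_right _ (by linarith)
        rw [hA₀]; linarith
      linarith
  · have h1 := hKup r hr
    have h2 : (1 : ℝ) ^ 3 ≤ (1 + r) ^ 3 := pow_le_pow_left₀ zero_le_one (by linarith) 3
    have h3 : r ^ 3 ≤ (1 + r) ^ 3 := pow_le_pow_left₀ hr (by linarith) 3
    rw [one_pow] at h2
    have h4 := mul_le_mul_of_nonneg_left h3 hε.le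
    have h5 := mul_le_mul_of_nonneg_left h2 hkM
    rw [hA₁]; linarith

/-- The far-field quartic is a supersolution: `12x² + (C − x/2)·4x³ ≤ (12 + 4C)(1 + x⁴)` for `x > 0`, `C ≥ 0`. [folklore] -/
theorem quartic_farField_ineq {C : ℝ} (hC : 0 ≤ C) (x : ℝ) (hx0 : 0 < x) :
    12 * x ^ 2 + (C - x / 2) * (4 * x ^ 3) ≤ (12 + 4 * C) * (1 + x ^ 4) := by
  have h1 : x ^ 2 ≤ 1 + x ^ 4 := by nlinarith only [sq_nonneg (x ^ 2 - 1), sq_nonneg x]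
  have h4 : 0 ≤ x ^ 4 := pow_nonneg hx0.le 4
  have h2 : x ^ 3 ≤ 1 + x ^ 4 := by
    have hsos : 0 ≤ (x - 1) ^ 2 * (3 * x ^ 2 + 2 * x + 1) :=
      mul_nonneg (sq_nonneg _) (by positivity)
    linarith only [hsos, h4]
  have h5 := mul_le_mul_of_nonneg_left h2 (by linarith : (0:ℝ) ≤ 4 * C)
  linarith only [h1, h5, h4]

/-- `d/dτ [a e^{−λ(τ−s₁)} k] = −λ · (a e^{−λ(σ−s₁)} k)`. [folklore] -/
theorem hasDerivAt_expDecay_mul (a lam s₁ k σ : ℝ) :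
    HasDerivAt (fun τ => a * Real.exp (-lam * (τ - s₁)) * k) ((-lam) * (a * Real.exp (-lam * (σ - s₁)) * k)) σ := by
  have h1 : HasDerivAt (fun τ => -lam * (τ - s₁)) (-lam * 1) σ :=
    ((hasDerivAt_id' σ).sub_const s₁).const_mul (-lam)
  have h2 := ((h1.exp).const_mul a).mul_const k
  refine h2.congr_deriv ?_
  ring

/-- `d/dτ [e^{ν(τ−s₁)} b] = ν · (e^{ν(σ−s₁)} b)`. [folklore] -/
theorem hasDerivAt_expGrowth_mul (ν s₁ b σ : ℝ) :
    HasDerivAt (fun τ => Real.exp (ν * (τ - s₁)) * b) (ν * (Real.exp (ν * (σ - s₁)) * b)) σ := by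
  have h1 : HasDerivAt (fun τ => ν * (τ - s₁)) (ν * 1) σ := ((hasDerivAt_id' σ).sub_const s₁).const_mul ν
  exact ((h1.exp).mul_const b).congr_deriv (by ring)

/-- `d/dr [e (1 + r⁴)] = e · 4r³`. [folklore] -/
theorem hasDerivAt_one_add_pow_four (e r : ℝ) :
    HasDerivAt (fun r : ℝ => e * (1 + r ^ 4)) (e * (4 * r ^ 3)) r := by
  have h0 : HasDerivAt (fun r : ℝ => r ^ 4) (4 * r ^ 3) r := by simpa using hasDerivAt_pow 4 r
  exact ((h0.const_add 1).const_mul e).congr_deriv (by ring)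

/-- `d/dr [e · 4r³] = e · 12r²`. [folklore] -/
theorem hasDerivAt_four_mul_pow_three (e r : ℝ) :
    HasDerivAt (fun r : ℝ => e * (4 * r ^ 3)) (e * (12 * r ^ 2)) r := by
  have h0 : HasDerivAt (fun r : ℝ => r ^ 3) (3 * r ^ 2) r := by simpa using hasDerivAt_pow 3 r
  exact ((h0.const_mul 4).const_mul e).congr_deriv (by ring)

/-- The decaying exponential is `λ`-Lipschitz from below in forward time:
`e^{−λ(σ′−s₁)} − e^{−λ(σ−s₁)} ≤ λ (σ − σ′)` for `s₁ ≤ σ′ ≤ σ`, `λ > 0`. [folklore] -/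
theorem exp_decay_sub_le {lam s₁ σ' σ : ℝ} (hlam : 0 < lam) (hσ' : s₁ ≤ σ') (hσ'σ : σ' ≤ σ) :
    Real.exp (-lam * (σ' - s₁)) - Real.exp (-lam * (σ - s₁)) ≤ lam * (σ - σ') := by
  have h6 : 0 ≤ lam * (σ - σ') := mul_nonneg hlam.le (by linarith)
  have h1 : Real.exp (-lam * (σ - s₁)) = Real.exp (-lam * (σ' - s₁)) * Real.exp (-lam * (σ - σ')) := by
    rw [← Real.exp_add]; ring_nf
  have h2 : -lam * (σ - σ') + 1 ≤ Real.exp (-lam * (σ - σ')) := Real.add_one_le_exp _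
  have h2' : 1 - Real.exp (-lam * (σ - σ')) ≤ lam * (σ - σ') := by linarith
  have h3 : Real.exp (-lam * (σ' - s₁)) ≤ 1 := by
    rw [Real.exp_le_one_iff]
    have : 0 ≤ lam * (σ' - s₁) := mul_nonneg hlam.le (by linarith)
    linarith
  have h4 : 0 ≤ Real.exp (-lam * (σ' - s₁)) := (Real.exp_pos _).le
  have h5 : Real.exp (-lam * (σ' - s₁)) - Real.exp (-lam * (σ - s₁))
      = Real.exp (-lam * (σ' - s₁)) * (1 - Real.exp (-lam * (σ - σ'))) := by rw [h1]; ring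
  rw [h5]
  calc Real.exp (-lam * (σ' - s₁)) * (1 - Real.exp (-lam * (σ - σ')))
      ≤ Real.exp (-lam * (σ' - s₁)) * (lam * (σ - σ')) := mul_le_mul_of_nonneg_left h2' h4
    _ ≤ 1 * (lam * (σ - σ')) := mul_le_mul_of_nonneg_right h3 h6
    _ = lam * (σ - σ') := one_mul _

end Summit.NavierStokesRegularity.NavierStokesRegularity.Theorems.PoloidalLiouville.NetFlux
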